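import Mathlib
import HarnessLib
import Summits.NavierStokesRegularity.NavierStokesRegularity.Theorems.UnthreadedDoorAntidynamoWallCoreReduction
import Summits.NavierStokesRegularity.NavierStokesRegularity.Theorems.UnthreadedDoorAntidynamoWallOneInstantZonal

/-!
# Route `UnthreadedDoor` / `ThreadingFlux`, crux `PoloidalLiouville` (stmt-NavierStokesRegularity-1222), antidynamo v2 skeleton (sha16 `4ebf5683127b`),
# WALL `stub_scalarLiouville`: THE WALL REDUCES TO ITS CORE, BY NAME — v2, with the ONE-INSTANT form of the flat-direction condition

Support file (seat leafhand-ns-unthreadeddoor-2 g2, cell decomp-ns), `--supports stmt-NavierStokesRegularity-1222 --as helper`; theorems only.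

`stubScalarLiouville_of_core'` sharpens the landed `stubScalarLiouville_of_core` (p817315): to prove the registered wall `Antidynamo.StubScalarLiouville`
(hence the crux `PoloidalLiouville` of both routes, `poloidalLiouville_of_core'`) it SUFFICES to prove its conclusion for flows of the wall's class that IN
ADDITION
(C1) are jointly REAL-ANALYTIC in their given frame on `(−∞,0) × ℝ³`;
(C2) have `{x | curl v(t,x) ≠ 0}` DENSE in `ℝ³` at every `t < 0`;
(C3') **at NO single time `t < 0`** admit a non-zero vector orthogonal to the vorticity on a non-empty open set — no local flat direction / local
      zonality / local second centre AT ANY INSTANT (v1 had this only at sets of times accumulating inside `(−∞,0)`; the upgrade is the one-instant Z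
      `OneInstant.curl_eq_zero_of_local_flat_direction_slice`: Oseen gauge + constant Galilean boost + one-slice symmetry propagation + Z-1b/Z-3);
(C4) are NOT anti-symmetric as a pseudovector about `x₀` under any linear isometry on any far past `(−∞, t₁)`;
(C5) are NOT generalized-Beltrami in any smooth Galilean frame on any far past (`curl((v − b) × ω) ≢ 0`).

HONEST LABEL: a by-name reduction (pure logic over landed closers); the core statement is OPEN (it is the wall on its residual); nothing here proves
`stub_scalarLiouville`, `PoloidalLiouville` (1222), or bears on Navier–Stokes regularity; no summit statement is proved (crux 1222 is INCOMPARABLE with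
the summit). [folklore] [cite: KochNadirashviliSereginSverak2009, Thm 5.2 (arXiv:0709.3599 pp. 9–10)]
-/

noncomputable section

-- the summit and its single sub-problem share the name (CONVENTIONS §1)
set_option linter.dupNamespace false

open scoped Topology InnerProductSpace RealInnerProductSpace ContDiff
open Filter Set Function Metric MeasureTheory
open Literature.Analysis.FluidPDE

namespace Summit.NavierStokesRegularity.NavierStokesRegularity.Theorems.PoloidalLiouville.Antidynamo

/-- **THE CORE OF THE WALL, v2** (a hypothesis shape, no new definition): the wall's conclusion for the flows of its class satisfying (C1), (C2), (C3'),
(C4), (C5) of the module docstring — (C3') being «no local flat direction at ANY single instant». -/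
theorem stubScalarLiouville_of_core'
    (hcore : ∀ (v : ℝ → EuclideanSpace ℝ (Fin 3) → EuclideanSpace ℝ (Fin 3)) (x₀ : EuclideanSpace ℝ (Fin 3))
      (T : ℝ → EuclideanSpace ℝ (Fin 3) → ℝ),
      Literature.Analysis.FluidPDE.IsBoundedAncientMildSolution 1 v →
      (∀ t < 0, AEStronglyMeasurable (v t) volume) →
      ContDiffOn ℝ (⊤ : ℕ∞) (Function.uncurry v) (Set.Iio 0 ×ˢ Set.univ) →
      ContDiffOn ℝ (⊤ : ℕ∞) (Function.uncurry T) (Set.Iio 0 ×ˢ ({x₀}ᶜ : Set (EuclideanSpace ℝ (Fin 3)))) →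
      (∃ C : ℝ, ∀ t < 0, ∀ x, |T t x| ≤ C) →
      (∀ t < 0, ∀ x, Literature.Analysis.FluidPDE.curl (v t) x =
        Literature.Analysis.FluidPDE.cross (gradient (T t) x) (x - x₀)) →
      (∀ t < 0, ∀ x, x ≠ x₀ →
        Literature.Analysis.FluidPDE.cross
            (gradient (fun z => deriv (fun s => T s z) t + inner ℝ (v t z) (gradient (T t) z)
              - Laplacian.laplacian (T t) z) x) (x - x₀) =
          Literature.Analysis.FluidPDE.cross (gradient (fun z => inner ℝ (v t z) (z - x₀)) x) (gradient (T t) x)) →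
      -- (C1) analytic in the given frame
      AnalyticOnNhd ℝ (Function.uncurry v) (Iio (0 : ℝ) ×ˢ (univ : Set (EuclideanSpace ℝ (Fin 3)))) →
      -- (C2) dense non-vanishing of the vorticity at every time
      (∀ t < 0, Dense {x : EuclideanSpace ℝ (Fin 3) | curl (v t) x ≠ 0}) →
      -- (C3') no local flat direction AT ANY INSTANT
      (∀ t < 0, ¬ ∃ e : EuclideanSpace ℝ (Fin 3), e ≠ 0 ∧
        ∃ U : Set (EuclideanSpace ℝ (Fin 3)), IsOpen U ∧ U.Nonempty ∧ ∀ x ∈ U, ⟪e, curl (v t) x⟫ = 0) →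
      -- (C4) not anti-symmetric under any linear isometry on any far past
      (∀ (R : EuclideanSpace ℝ (Fin 3) ≃ₗᵢ[ℝ] EuclideanSpace ℝ (Fin 3)) (t₁ : ℝ), t₁ ≤ 0 →
        ¬ ∀ t < t₁, ∀ y, curl (v t) (x₀ + R y) =
          -((R : EuclideanSpace ℝ (Fin 3) →L[ℝ] EuclideanSpace ℝ (Fin 3)).det • R (curl (v t) (x₀ + y)))) →
      -- (C5) not generalized-Beltrami in any smooth Galilean frame on any far past
      (∀ (t₁ : ℝ), t₁ ≤ 0 → ∀ b : ℝ → EuclideanSpace ℝ (Fin 3), ContDiffOn ℝ ∞ b (Iio t₁) →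
        ¬ ∀ t < t₁, ∀ x, curl (fun y => cross (v t y - b t) (curl (v t) y)) x = 0) →
      ∀ t < 0, ∀ x, Literature.Analysis.FluidPDE.cross (gradient (T t) x) (x - x₀) = 0) :
    StubScalarLiouville := by
  refine stubScalarLiouville_of_core fun v x₀ T hB hm hsm hT hTb hrep hE hC1 hC2 _ hC4 hC5 => ?_
  -- a toroidal field is tangent to the spheres about its centre
  have hun : ∀ t < 0, ∀ x, ⟪x - x₀, curl (v t) x⟫ = 0 := fun t ht x => by
    rw [hrep t ht x]
    simp [cross, crossProduct, PiLp.inner_apply, Fin.sum_univ_three]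
    ring
  by_cases h0 : ∀ t < 0, ∀ x, curl (v t) x = 0
  · intro t ht x
    rw [← hrep t ht x]
    exact h0 t ht x
  -- otherwise (C3') holds: a local flat direction at one instant would make the flow irrotational
  have hC3' : ∀ t < 0, ¬ ∃ e : EuclideanSpace ℝ (Fin 3), e ≠ 0 ∧
      ∃ U : Set (EuclideanSpace ℝ (Fin 3)), IsOpen U ∧ U.Nonempty ∧ ∀ x ∈ U, ⟪e, curl (v t) x⟫ = 0 := by
    rintro t ht ⟨e, he, U, hUo, hUne, hU⟩
    exact h0 (OneInstant.curl_eq_zero_of_local_flat_direction_slice v x₀ hB hm hsm hun ⟨t, ht, e, he, U, hUo, hUne, hU⟩)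
  exact hcore v x₀ T hB hm hsm hT hTb hrep hE hC1 hC2 hC3' hC4 hC5

/-- **… AND THE CRUX**: the same v2 core statement gives `PoloidalLiouville` (route `UnthreadedDoor` decl; composition p793469 by name). -/
theorem poloidalLiouville_of_core'
    (hcore : ∀ (v : ℝ → EuclideanSpace ℝ (Fin 3) → EuclideanSpace ℝ (Fin 3)) (x₀ : EuclideanSpace ℝ (Fin 3))
      (T : ℝ → EuclideanSpace ℝ (Fin 3) → ℝ),
      Literature.Analysis.FluidPDE.IsBoundedAncientMildSolution 1 v →
      (∀ t < 0, AEStronglyMeasurable (v t) volume) →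
      ContDiffOn ℝ (⊤ : ℕ∞) (Function.uncurry v) (Set.Iio 0 ×ˢ Set.univ) →
      ContDiffOn ℝ (⊤ : ℕ∞) (Function.uncurry T) (Set.Iio 0 ×ˢ ({x₀}ᶜ : Set (EuclideanSpace ℝ (Fin 3)))) →
      (∃ C : ℝ, ∀ t < 0, ∀ x, |T t x| ≤ C) →
      (∀ t < 0, ∀ x, Literature.Analysis.FluidPDE.curl (v t) x =
        Literature.Analysis.FluidPDE.cross (gradient (T t) x) (x - x₀)) →
      (∀ t < 0, ∀ x, x ≠ x₀ →
        Literature.Analysis.FluidPDE.cross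
            (gradient (fun z => deriv (fun s => T s z) t + inner ℝ (v t z) (gradient (T t) z)
              - Laplacian.laplacian (T t) z) x) (x - x₀) =
          Literature.Analysis.FluidPDE.cross (gradient (fun z => inner ℝ (v t z) (z - x₀)) x) (gradient (T t) x)) →
      AnalyticOnNhd ℝ (Function.uncurry v) (Iio (0 : ℝ) ×ˢ (univ : Set (EuclideanSpace ℝ (Fin 3)))) →
      (∀ t < 0, Dense {x : EuclideanSpace ℝ (Fin 3) | curl (v t) x ≠ 0}) →
      (∀ t < 0, ¬ ∃ e : EuclideanSpace ℝ (Fin 3), e ≠ 0 ∧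
        ∃ U : Set (EuclideanSpace ℝ (Fin 3)), IsOpen U ∧ U.Nonempty ∧ ∀ x ∈ U, ⟪e, curl (v t) x⟫ = 0) →
      (∀ (R : EuclideanSpace ℝ (Fin 3) ≃ₗᵢ[ℝ] EuclideanSpace ℝ (Fin 3)) (t₁ : ℝ), t₁ ≤ 0 →
        ¬ ∀ t < t₁, ∀ y, curl (v t) (x₀ + R y) =
          -((R : EuclideanSpace ℝ (Fin 3) →L[ℝ] EuclideanSpace ℝ (Fin 3)).det • R (curl (v t) (x₀ + y)))) →
      (∀ (t₁ : ℝ), t₁ ≤ 0 → ∀ b : ℝ → EuclideanSpace ℝ (Fin 3), ContDiffOn ℝ ∞ b (Iio t₁) →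
        ¬ ∀ t < t₁, ∀ x, curl (fun y => cross (v t y - b t) (curl (v t) y)) x = 0) →
      ∀ t < 0, ∀ x, Literature.Analysis.FluidPDE.cross (gradient (T t) x) (x - x₀) = 0) :
    Summit.NavierStokesRegularity.NavierStokesRegularity.Theses.UnthreadedDoor.PoloidalLiouville :=
  poloidalLiouville_of_stubScalarLiouville' (stubScalarLiouville_of_core' hcore)

end Summit.NavierStokesRegularity.NavierStokesRegularity.Theorems.PoloidalLiouville.Antidynamo

end
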